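import Literature.Barriers.ABC.BakerMethodBoundsStewartYu1991LineRestrictedProofs
import Summits.ABC.ABC.Theorems.AbcExplicitSocket
import HarnessLib

/-!
# The Stewart–Yu 1991 door with its constant WRITTEN OUT (papers lane ABC-P1, writer seat; theorems only)

`Summits/ABC/ABC/Theorems/AbcExplicitTwoThirdsDoor.lean`.  The door
`Literature.Barriers.ABC.stewartYu1991_of_yu1990Restricted_waldschmidt1980` (file
`BakerMethodBoundsStewartYu1991LineRestrictedProofs.lean`, ll. 609–710) concludes the `∃ κ c₀`-statement
`stewartYu1991_upperBound`; its proof instantiates `c₀ := 3` and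
`κ(ε') := (6K/ε)^{1/(1−ε)}`, `ε = min(1/2, 3ε'/8)`, `K = (23040000·A·(12/ε)^{12})^{1/3}`, `D = (600·C)^2`,
`C = 2·max(1, |c₅|, |c₆|)`, with `A` from the `∃`-lemma `exists_pow_le_mul_rpow` (Lemma 4 once more).  Here the SAME
proof is re-run with the existential opened: `A := D^{⌈D^{1/ε}⌉}` by the explicit Lemma-4 bound
`pow_card_le_prod_rpow_explicit` (`AbcExplicitSocket.lean`, p478627 — the only declaration of that module used here),
the archimedean input discharged by the tree's
`waldschmidt1980_hW₂` (`c₆ = 2^70`) exactly as in `stewartYu1991_of_yu1990Restricted`, so that the conclusion is the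
threshold-`3` bound `log c ≤ κ(c₅, ε') · rad(abc)^{2/3+ε'}` with `κ(c₅, ε')` a CLOSED TERM of the statement:

* `abc_log_le_explicit_twoThirds_of_yu1990Restricted` — from the restricted Yu binder with constant `c₅`;
* `abc_log_le_explicit_twoThirds_of_w80Shape` — from the Waldschmidt-shape `p`-adic text at every prime with
  constant `c₅` (binder constant `2|c₅|`, `yu1990Restricted_of_w80Shape`).

No new definition; [folklore] bookkeeping on landed theorems ([cite: StewartYu1991, §3 (9)–(18)] for the line).
WHAT THIS IS NOT: no `p`-adic estimate is proved here, and no arithmetical use of the constant is claimed.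
-/

set_option linter.dupNamespace false

noncomputable section

open Finset Real Height
open Literature.NumberTheory.DiophantineGeometry
open Literature.NumberTheory.DiophantineGeometry.Dioph
open Literature.NumberTheory.DiophantineGeometry.Pasten
open Literature.NumberTheory.Transcendental.Waldschmidt1980
open Literature.Barriers.ABC

namespace Summit.ABC.ABC.Theorems

set_option maxHeartbeats 800000 in
/-- **Stewart–Yu 1991 with an EXPLICIT constant, from the restricted Yu binder.** If at every prime `p` the
restricted one-prime text holds with constant `c₅` (`ord_p(∏ q^{e_q} − 1) < (c₅ #S)^{#S} p² log B · log log A · ∏ log max(4,q)`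
whenever `log log A ≤ log B`), then for every `ε' > 0` and every abc triple with `c ≥ 3`:
`log c ≤ κ(c₅, ε') · rad(abc)^{2/3+ε'}` with
`κ(c₅, ε') = (6·(23040000·D^{⌈D^{1/ε}⌉}·(12/ε)^{12})^{1/3}/ε)^{1/(1−ε)}`, `ε = min(1/2, 3ε'/8)`,
`D = (600·2·max(1, |c₅|, 2^70))^2` (`|2^70|` simplified) — the witness of `stewartYu1991_of_yu1990Restricted_waldschmidt1980` with Lemma 4 made
explicit (`pow_card_le_prod_rpow_explicit`) and Lemma 2 = the tree's `waldschmidt1980_hW₂` (`c₆ = 2^70`).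
[cite: StewartYu1991, §3 (13)–(18)] -/
theorem abc_log_le_explicit_twoThirds_of_yu1990Restricted (c₅ : ℝ)
    (hY : ∀ (p : ℕ), p.Prime → ∀ (S : Finset ℕ), (∀ q ∈ S, q.Prime) → p ∉ S → S.Nonempty →
      ∀ (e : ℕ → ℤ) (B : ℝ), 3 ≤ B → (∀ q ∈ S, (|e q| : ℝ) ≤ B) →
      Real.log (Real.log ((max 4 (S.sup id) : ℕ) : ℝ)) ≤ Real.log B →
      ∏ q ∈ S, (q : ℚ) ^ e q ≠ 1 →
      (padicValRat p (∏ q ∈ S, (q : ℚ) ^ e q - 1) : ℝ) <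
        (c₅ * S.card) ^ S.card * (p : ℝ) ^ 2 * Real.log B *
          Real.log (Real.log ((max 4 (S.sup id) : ℕ) : ℝ)) *
          ∏ q ∈ S, Real.log ((max 4 q : ℕ) : ℝ))
    {ε' : ℝ} (hε' : 0 < ε') :
    ∀ a b c : ℕ, IsABCTriple a b c → 3 ≤ c →
      Real.log c ≤
        (6 * (23040000 *
              ((600 * (2 * max (max 1 |c₅|) (2 ^ 70 : ℝ))) ^ 2) ^
                ⌈((600 * (2 * max (max 1 |c₅|) (2 ^ 70 : ℝ))) ^ 2) ^ (1 / min (1 / 2) (3 * ε' / 8))⌉₊ *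
              (12 / min (1 / 2) (3 * ε' / 8)) ^ 12) ^ (1 / 3 : ℝ) /
            min (1 / 2) (3 * ε' / 8)) ^ (1 / (1 - min (1 / 2) (3 * ε' / 8))) *
          (rad a b c : ℝ) ^ (2 / 3 + ε' : ℝ) := by
  -- the parameters `ε`, `C`, `D`, `A`, `K`, `θ`, `κ` (as in `stewartYu1991_of_yu1990Restricted_waldschmidt1980`)
  set ε : ℝ := min (1 / 2) (3 * ε' / 8) with hεdef
  have hε0 : 0 < ε := lt_min (by norm_num) (by positivity)
  have hε2 : ε ≤ 1 / 2 := min_le_left _ _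
  have hε38 : ε ≤ 3 * ε' / 8 := min_le_right _ _
  set C : ℝ := 2 * max (max 1 |c₅|) (2 ^ 70 : ℝ) with hC
  have hm1 : 1 ≤ max (max 1 |c₅|) (2 ^ 70 : ℝ) := le_max_of_le_left (le_max_left _ _)
  have hC1 : 1 ≤ C := by rw [hC]; linarith
  set D : ℝ := (600 * C) ^ 2 with hD
  have hD1 : 1 ≤ D := by rw [hD]; exact one_le_pow₀ (by linarith)
  set A : ℝ := D ^ ⌈D ^ (1 / ε)⌉₊ with hAdef
  have hA1 : 1 ≤ A := one_le_pow₀ hD1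
  set K₀ : ℝ := 23040000 * A * (12 / ε) ^ 12 with hK₀
  have h12ε : 1 ≤ 12 / ε := by rw [le_div_iff₀ hε0]; linarith
  have hK₀1 : 1 ≤ K₀ := by
    rw [hK₀]
    have h1 : (1 : ℝ) ≤ 23040000 * A := by nlinarith
    exact one_le_mul_of_one_le_of_one_le h1 (one_le_pow₀ h12ε)
  set K : ℝ := K₀ ^ (1 / 3 : ℝ) with hK
  have hK1 : 1 ≤ K := Real.one_le_rpow hK₀1 (by norm_num)
  have hK3 : K ^ 3 = K₀ := by
    rw [hK, ← Real.rpow_natCast, ← Real.rpow_mul (by linarith)]; norm_num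
  set θ : ℝ := (2 + 2 * ε) / 3 with hθ
  set κ : ℝ := (6 * K / ε) ^ (1 / (1 - ε)) with hκ
  have hκ0 : 0 ≤ κ := Real.rpow_nonneg (by positivity) _
  have hexp : θ / (1 - ε) ≤ 2 / 3 + ε' := by
    rw [div_le_iff₀ (by linarith), hθ]
    have h1 : ε' * ε ≤ ε' / 2 := by nlinarith
    nlinarith
  -- reduce to `a ≤ b`
  suffices main : ∀ a b c : ℕ, IsABCTriple a b c → a ≤ b → 3 ≤ c →
      Real.log c ≤ κ * (rad a b c : ℝ) ^ (2 / 3 + ε' : ℝ) by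
    intro a b c h hc
    rcases le_total a b with hab | hba
    · exact main a b c h hab hc
    · have := main b a c h.swap hba hc
      rwa [rad_swap] at this
  intro a b c h hab hc3
  -- (17)–(18) of the paper with Lemma 2 = `waldschmidt1980_hW₂` (`c₆ = 2^70`)
  have hA' := log_pow_three_le_of_yu1990Restricted_waldschmidt1980 w80Cw c₅ (2 ^ 70) w80Cw_nonneg
    (fun n => w80Cw_le n) hY
    (fun n α b V W h1 h2 h3 h4 h5 h6 h7 h8 => waldschmidt1980_hW₂ n α b V W h1 h2 h3 h4 h5 h6 h7 h8)
    h hab hc3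
  rw [show |(2 : ℝ) ^ 70| = 2 ^ 70 from abs_of_pos (by positivity)] at hA'
  rw [← hC, ← hD] at hA'
  set G : ℝ := (rad a b c : ℝ) with hGdef
  set r : ℕ := (a * b * c).primeFactors.card with hr
  have hradpos : 0 < rad a b c := by rw [rad_def]; exact Nat.radical_pos _
  have hG1 : (1 : ℝ) ≤ G := by rw [hGdef]; exact_mod_cast hradpos
  have hG0 : (0 : ℝ) < G := by linarith
  -- `D^r ≤ A G^ε` (Lemma 4, explicit) and `(log G)^{12} ≤ (12/ε)^{12} G^ε`
  have hDr : D ^ r ≤ A * G ^ ε := by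
    have h1 := pow_card_le_prod_rpow_explicit hD1 hε0 (a * b * c).primeFactors
      (fun q hq => Nat.prime_of_mem_primeFactors hq)
    have hradS : (((∏ q ∈ (a * b * c).primeFactors, q : ℕ)) : ℝ) = G := by
      rw [hGdef, rad_def, Nat.radical_eq_prod_primeFactors]
    rw [hradS] at h1
    exact h1
  have hLG : Real.log G ^ 12 ≤ (12 / ε) ^ 12 * G ^ ε := by
    have h1 : Real.log G ≤ G ^ (ε / 12) / (ε / 12) := Real.log_le_rpow_div hG0.le (by positivity)
    have h2 : 0 ≤ Real.log G := Real.log_nonneg hG1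
    have e : (G ^ (ε / 12)) ^ (12 : ℕ) = G ^ ε := by
      rw [← Real.rpow_natCast, ← Real.rpow_mul hG0.le]; congr 1; push_cast; ring
    calc Real.log G ^ 12 ≤ (G ^ (ε / 12) / (ε / 12)) ^ 12 := pow_le_pow_left₀ h2 h1 12
      _ = (12 / ε) ^ 12 * G ^ ε := by rw [div_pow, e]; field_simp
  -- `(log c)³ ≤ K³ G^{3θ} log(6 log c)³`
  have hc3r : (3 : ℝ) ≤ c := by exact_mod_cast hc3
  have hlogc1 : 1 ≤ Real.log c := by
    rw [← Real.log_exp 1]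
    apply Real.log_le_log (Real.exp_pos 1)
    have := Real.exp_one_lt_d9; linarith
  have hLc0 : 0 ≤ Real.log (6 * Real.log c) := Real.log_nonneg (by linarith)
  have hGε : G ^ (3 * θ) = G ^ 2 * G ^ ε * G ^ ε := by
    rw [hθ, show (3 : ℝ) * ((2 + 2 * ε) / 3) = 2 + ε + ε by ring, Real.rpow_add hG0,
      Real.rpow_add hG0, Real.rpow_two]
  have hcube : Real.log c ^ 3 ≤ K ^ 3 * G ^ (3 * θ) * Real.log (6 * Real.log c) ^ 3 := by
    calc Real.log c ^ 3
        ≤ 23040000 * D ^ r * G ^ 2 * Real.log G ^ 12 * Real.log (6 * Real.log c) ^ 3 := hA'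
      _ ≤ 23040000 * (A * G ^ ε) * G ^ 2 * ((12 / ε) ^ 12 * G ^ ε) * Real.log (6 * Real.log c) ^ 3 := by
          apply mul_le_mul_of_nonneg_right _ (pow_nonneg hLc0 3)
          apply mul_le_mul _ hLG (pow_nonneg (Real.log_nonneg hG1) 12) (by positivity)
          exact mul_le_mul_of_nonneg_right (mul_le_mul_of_nonneg_left hDr (by norm_num)) (by positivity)
      _ = K ^ 3 * G ^ (3 * θ) * Real.log (6 * Real.log c) ^ 3 := by rw [hK3, hK₀, hGε]; ring
  have hfin := le_of_pow_three_le_log hK1 hε0 hε2 hlogc1 hG1 hcube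
  calc Real.log c ≤ (6 * K / ε) ^ (1 / (1 - ε)) * G ^ (θ / (1 - ε)) := hfin
    _ ≤ κ * G ^ (2 / 3 + ε' : ℝ) := by
        rw [← hκ]
        exact mul_le_mul_of_nonneg_left (Real.rpow_le_rpow_of_exponent_le hG1 hexp) hκ0

/-- **Stewart–Yu 1991 with an EXPLICIT constant, from the Waldschmidt-shape `p`-adic text at every prime.** If at
every prime `p` the one-prime text `ord_p(∏ q^{e_q} − 1) < (c₅ #S)^{#S} p² (log B + log log A) log log A ∏ log max(4,q)`
holds (the shape the cell's three engines deliver, `A = max(4, max S)`, `|e_q| ≤ B`, `B ≥ 3`), then for every `ε' > 0`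
and every abc triple with `c ≥ 3`: `log c ≤ κ(2|c₅|, ε') · rad(abc)^{2/3+ε'}`, with the closed term of
`abc_log_le_explicit_twoThirds_of_yu1990Restricted` at the binder constant `2|c₅|` (`yu1990Restricted_of_w80Shape`).
This is `stewartYu1991_of_w80Shape` with its `∃ κ c₀` opened (`c₀ = 3`). [cite: StewartYu1991, Theorem (p. 226), §3 (9)–(18)] -/
theorem abc_log_le_explicit_twoThirds_of_w80Shape (c₅ : ℝ)
    (hW : ∀ (p : ℕ), p.Prime → ∀ (S : Finset ℕ), (∀ q ∈ S, q.Prime) → p ∉ S → S.Nonempty →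
      ∀ (e : ℕ → ℤ) (B : ℝ), 3 ≤ B → (∀ q ∈ S, (|e q| : ℝ) ≤ B) →
      ∏ q ∈ S, (q : ℚ) ^ e q ≠ 1 →
      (padicValRat p (∏ q ∈ S, (q : ℚ) ^ e q - 1) : ℝ) <
        (c₅ * S.card) ^ S.card * (p : ℝ) ^ 2 *
          ((Real.log B + Real.log (Real.log ((max 4 (S.sup id) : ℕ) : ℝ))) *
            Real.log (Real.log ((max 4 (S.sup id) : ℕ) : ℝ))) *
          ∏ q ∈ S, Real.log ((max 4 q : ℕ) : ℝ))
    {ε' : ℝ} (hε' : 0 < ε') :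
    ∀ a b c : ℕ, IsABCTriple a b c → 3 ≤ c →
      Real.log c ≤
        (6 * (23040000 *
              ((600 * (2 * max (max 1 (2 * |c₅|)) (2 ^ 70 : ℝ))) ^ 2) ^
                ⌈((600 * (2 * max (max 1 (2 * |c₅|)) (2 ^ 70 : ℝ))) ^ 2) ^ (1 / min (1 / 2) (3 * ε' / 8))⌉₊ *
              (12 / min (1 / 2) (3 * ε' / 8)) ^ 12) ^ (1 / 3 : ℝ) /
            min (1 / 2) (3 * ε' / 8)) ^ (1 / (1 - min (1 / 2) (3 * ε' / 8))) *
          (rad a b c : ℝ) ^ (2 / 3 + ε' : ℝ) := by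
  have h := abc_log_le_explicit_twoThirds_of_yu1990Restricted (2 * |c₅|) (yu1990Restricted_of_w80Shape c₅ hW) hε'
  rw [abs_of_nonneg (show (0 : ℝ) ≤ 2 * |c₅| by positivity)] at h
  exact h

end Summit.ABC.ABC.Theorems

end
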